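import Summits.AtomisticToContinuum.FouriersLaw.Theses.BondHeatUncertainty
import Literature.Probability.Entropy.FluctuationTheoremUncertainty

/-!
# crux-triage r1 k1 (gen 2) — Lean probe for card `odd-density-dual-correctors`
(crux stmt-AtomisticToContinuum-9122, `BondHeatUncertainty.LinearResponseFTUR`)

Sharpening (s1), kernel-checked: the card's first lemma (a) `OddSnapshotCauchySchwarz`
(`(∫ φ dμ)² ≤ ½·KL(μ‖Θ_*μ)·∫ φ² dμ` for Θ-odd `φ`) is TRUE (paper proof in TRIAGE.md) but need not be
proved for the line: the LANDED fact `Literature.Probability.Entropy.HasegawaVanVu2019_FTUR_holds`,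
instantiated on the SNAPSHOT `(Ω, P, ι) := (PhaseSpace N, μ, Θ)`, already gives
`(∫ φ dμ)² ≤ ½ · Var_μ(φ) · (e^{KL(μ‖Θ_*μ)} − 1)` (`snapshot_hvv`, `snapshot_hvv'`), whose `δ⁻²`-limit
along the crux hypothesis `KL(μ_δ‖Θ_*μ_δ) ≤ Kδ²` is the same `2c² ≤ K·V` as the card's `K_side_limit`
(`K_side_limit_exp`, `K_side_of_hvv_family`: `(e^{Kδ²} − 1)/δ² → K`). So the K-side of the card costs
nothing beyond `DualResponseLimit` + `StaticContinuity` + `EquilibriumAlgebra (iii)`.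
-/

namespace Summit.AtomisticToContinuum.FouriersLaw.Cruxes.LinearResponseFTUR.TriageR11

open MeasureTheory ProbabilityTheory InformationTheory Filter Topology
open scoped ENNReal
open Literature.MathematicalPhysics.KineticTheory.HeatConduction

/-- **HVV on the snapshot.** For a probability measure `μ` on phase space and a Θ-odd `φ ∈ L²(μ)`
with `KL(μ ‖ Θ_*μ) < ∞` (`Θ = momentumReversal N`):
`(∫ φ dμ)² ≤ ½ · Var_μ(φ) · (exp KL(μ‖Θ_*μ) − 1)` — an instance of the in-tree Hasegawa–Van Vu fact. -/
theorem snapshot_hvv {N : ℕ} (μ : Measure (PhaseSpace N)) [IsProbabilityMeasure μ]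
    (φ : PhaseSpace N → ℝ) (hodd : ∀ x : PhaseSpace N, φ (x.1, -x.2) = -φ x) (hφ : MemLp φ 2 μ)
    (hKL : klDiv μ (μ.map (momentumReversal N)) ≠ ⊤) :
    (∫ x, φ x ∂μ) ^ 2 ≤
      (1 / 2) * variance φ μ * (Real.exp (klDiv μ (μ.map (momentumReversal N))).toReal - 1) := by
  have hΘm : Measurable (momentumReversal N) := (momentumReversal N).measurable
  have hΘinv : Function.Involutive (momentumReversal N) := by
    intro x
    simp [momentumReversal_apply]
  obtain ⟨hac, hint⟩ := klDiv_ne_top_iff.mp hKL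
  have hΘΘ : (⇑(momentumReversal N)) ∘ (⇑(momentumReversal N)) = id := by
    funext x
    simp [momentumReversal_apply]
  have hback : (μ.map (momentumReversal N)).map (momentumReversal N) = μ := by
    rw [Measure.map_map hΘm hΘm, hΘΘ, Measure.map_id]
  have hac' : μ.map (momentumReversal N) ≪ μ := by
    have h2 := hac.map hΘm
    rwa [hback] at h2
  have hodd' : ∀ x : PhaseSpace N, φ ((momentumReversal N) x) = -φ x := fun x => by
    rw [momentumReversal_apply]; exact hodd x
  haveI : IsProbabilityMeasure (μ.map (momentumReversal N)) :=
    Measure.isProbabilityMeasure_map hΘm.aemeasurable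
  have heq : (klDiv μ (μ.map (momentumReversal N))).toReal =
      ∫ x, llr μ (μ.map (momentumReversal N)) x ∂μ :=
    toReal_klDiv_of_measure_eq hac (by simp)
  rw [heq]
  exact Literature.Probability.Entropy.HasegawaVanVu2019_FTUR_holds (PhaseSpace N) μ
    (momentumReversal N) hΘm hΘinv hac hac' hint φ hφ hodd'

/-- Same statement with the crux's literal flip `fun x => (x.1, -x.2)`. -/
theorem snapshot_hvv' {N : ℕ} (μ : Measure (PhaseSpace N)) [IsProbabilityMeasure μ]
    (φ : PhaseSpace N → ℝ) (hodd : ∀ x : PhaseSpace N, φ (x.1, -x.2) = -φ x) (hφ : MemLp φ 2 μ)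
    (hKL : klDiv μ (μ.map fun x : PhaseSpace N => (x.1, -x.2)) ≠ ⊤) :
    (∫ x, φ x ∂μ) ^ 2 ≤
      (1 / 2) * variance φ μ *
        (Real.exp (klDiv μ (μ.map fun x : PhaseSpace N => (x.1, -x.2))).toReal - 1) := by
  have e : (fun x : PhaseSpace N => (x.1, -x.2)) = ⇑(momentumReversal N) := by
    funext x; rfl
  rw [e] at hKL ⊢
  exact snapshot_hvv μ φ hodd hφ hKL

/-- Pointwise step: feed the crux hypothesis `KL ≤ Kδ²` into the snapshot HVV bound. -/
theorem snapshot_step {m v kl K δ : ℝ} (h : m ^ 2 ≤ 1 / 2 * v * (Real.exp kl - 1)) (hv : 0 ≤ v)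
    (hkl : kl ≤ K * δ ^ 2) : m ^ 2 ≤ 1 / 2 * v * (Real.exp (K * δ ^ 2) - 1) := by
  have : Real.exp kl - 1 ≤ Real.exp (K * δ ^ 2) - 1 := by
    linarith [Real.exp_le_exp.mpr hkl]
  exact h.trans (mul_le_mul_of_nonneg_left this (by positivity))

/-- `exp x - 1 ≤ x · exp x`. -/
theorem exp_sub_one_le_mul_exp (x : ℝ) : Real.exp x - 1 ≤ x * Real.exp x := by
  have h := Real.add_one_le_exp (-x)
  have hx := Real.exp_pos x
  have : Real.exp (-x) * Real.exp x = 1 := by rw [← Real.exp_add]; simp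
  nlinarith

/-- **The `δ → 0` step with the exponential** (replaces the card's `K_side_limit`): an eventual bound
`m(δ)² ≤ ½ v(δ) (e^{Kδ²} − 1)` with `m(δ)/δ → c`, `v(δ) → V` forces `2c² ≤ K·V`. -/
theorem K_side_limit_exp {m v : ℝ → ℝ} {c V K : ℝ}
    (hm : Tendsto (fun δ => m δ / δ) (𝓝[≠] 0) (𝓝 c))
    (hv : Tendsto v (𝓝[≠] 0) (𝓝 V))
    (hv0 : ∀ᶠ δ in 𝓝[≠] (0 : ℝ), 0 ≤ v δ)
    (hev : ∀ᶠ δ in 𝓝[≠] (0 : ℝ), m δ ^ 2 ≤ 1 / 2 * v δ * (Real.exp (K * δ ^ 2) - 1)) :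
    2 * c ^ 2 ≤ K * V := by
  have hsq : Tendsto (fun δ : ℝ => δ ^ 2) (𝓝[≠] 0) (𝓝 0) := by
    have : Tendsto (fun δ : ℝ => δ ^ 2) (𝓝 0) (𝓝 (0 ^ 2)) := (continuous_pow 2).tendsto 0
    simpa using this.mono_left nhdsWithin_le_nhds
  have hexp : Tendsto (fun δ : ℝ => Real.exp (K * δ ^ 2)) (𝓝[≠] 0) (𝓝 1) := by
    have h1 : Tendsto (fun δ : ℝ => K * δ ^ 2) (𝓝[≠] 0) (𝓝 (K * 0)) := hsq.const_mul K
    have := (Real.continuous_exp.tendsto _).comp h1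
    simpa [Function.comp_def] using this
  have hq : ∀ᶠ δ in 𝓝[≠] (0 : ℝ), (m δ / δ) ^ 2 ≤ 1 / 2 * v δ * (K * Real.exp (K * δ ^ 2)) := by
    filter_upwards [hev, hv0, self_mem_nhdsWithin] with δ h1 h2 hne
    have hδ0 : (δ : ℝ) ≠ 0 := hne
    have hδ2 : 0 < δ ^ 2 := by positivity
    have h3 : Real.exp (K * δ ^ 2) - 1 ≤ K * δ ^ 2 * Real.exp (K * δ ^ 2) :=
      exp_sub_one_le_mul_exp _
    have h4 : m δ ^ 2 ≤ 1 / 2 * v δ * (K * δ ^ 2 * Real.exp (K * δ ^ 2)) :=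
      h1.trans (mul_le_mul_of_nonneg_left h3 (by positivity))
    rw [div_pow, div_le_iff₀ hδ2]
    calc m δ ^ 2 ≤ 1 / 2 * v δ * (K * δ ^ 2 * Real.exp (K * δ ^ 2)) := h4
      _ = 1 / 2 * v δ * (K * Real.exp (K * δ ^ 2)) * δ ^ 2 := by ring
  have hL : Tendsto (fun δ => (m δ / δ) ^ 2) (𝓝[≠] 0) (𝓝 (c ^ 2)) := hm.pow 2
  have hR : Tendsto (fun δ => 1 / 2 * v δ * (K * Real.exp (K * δ ^ 2))) (𝓝[≠] 0)
      (𝓝 (1 / 2 * V * (K * 1))) :=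
    (tendsto_const_nhds.mul hv).mul (tendsto_const_nhds.mul hexp)
  have key := le_of_tendsto_of_tendsto hL hR hq
  nlinarith [key]

/-- **Assembly (the card's `K_ge_k_of_levers` with HVV in place of `OddSnapshotCauchySchwarz`).**
`KL δ` = the snapshot KL at bias `δ`, `m δ = ∫ φ dμ_δ`, `v δ = Var_δ(φ)`; the `hHVV` hypothesis is
`snapshot_hvv'` at each small `δ`; `hyp` is the crux's hypothesis; `hm`, `hv` are the card's
`DualResponseLimit` (with `F = Z_b`) and `StaticContinuity`; with `c = V/2` (`EquilibriumAlgebra` (iii),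
`V = ‖φ_b‖²`) the conclusion reads `V/2 ≤ K`, i.e. `k_b = 2‖h_odd‖² ≤ K`. -/
theorem K_side_of_hvv_family {KL : ℝ → ℝ≥0∞} {m v : ℝ → ℝ} {c V K : ℝ} (hK : 0 ≤ K)
    (hHVV : ∀ᶠ δ in 𝓝[≠] (0 : ℝ), KL δ ≠ ⊤ →
      m δ ^ 2 ≤ 1 / 2 * v δ * (Real.exp (KL δ).toReal - 1))
    (hv0 : ∀ᶠ δ in 𝓝[≠] (0 : ℝ), 0 ≤ v δ)
    (hm : Tendsto (fun δ => m δ / δ) (𝓝[≠] 0) (𝓝 c)) (hv : Tendsto v (𝓝[≠] 0) (𝓝 V))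
    (hyp : ∀ᶠ δ in 𝓝[≠] (0 : ℝ), KL δ ≤ ENNReal.ofReal (K * δ ^ 2)) :
    2 * c ^ 2 ≤ K * V := by
  refine K_side_limit_exp hm hv hv0 ?_
  filter_upwards [hHVV, hv0, hyp] with δ h1 h2 h3
  have hne : KL δ ≠ ⊤ := ne_top_of_le_ne_top ENNReal.ofReal_ne_top h3
  have h4 : (KL δ).toReal ≤ K * δ ^ 2 := by
    have := ENNReal.toReal_mono ENNReal.ofReal_ne_top h3
    rwa [ENNReal.toReal_ofReal (by positivity)] at this
  exact snapshot_step (h1 hne) h2 h4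

/-- With `c = V/2` (the card's algebra (iii)) the assembly gives `V/2 ≤ K`. -/
theorem k_le_K_of_hvv_family {KL : ℝ → ℝ≥0∞} {m v : ℝ → ℝ} {V K : ℝ} (hK : 0 ≤ K)
    (hHVV : ∀ᶠ δ in 𝓝[≠] (0 : ℝ), KL δ ≠ ⊤ →
      m δ ^ 2 ≤ 1 / 2 * v δ * (Real.exp (KL δ).toReal - 1))
    (hv0 : ∀ᶠ δ in 𝓝[≠] (0 : ℝ), 0 ≤ v δ)
    (hm : Tendsto (fun δ => m δ / δ) (𝓝[≠] 0) (𝓝 (V / 2))) (hv : Tendsto v (𝓝[≠] 0) (𝓝 V))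
    (hyp : ∀ᶠ δ in 𝓝[≠] (0 : ℝ), KL δ ≤ ENNReal.ofReal (K * δ ^ 2)) :
    V / 2 ≤ K := by
  have h := K_side_of_hvv_family hK hHVV hv0 hm hv hyp
  have hV0 : 0 ≤ V := le_of_tendsto_of_tendsto tendsto_const_nhds hv hv0
  rcases hV0.lt_or_eq with hpos | hzero
  · nlinarith
  · rw [← hzero]; simpa using hK

end Summit.AtomisticToContinuum.FouriersLaw.Cruxes.LinearResponseFTUR.TriageR11
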